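import Summits.CriticalPhenomena.Ising3D.Control2DEps101MidA
import HarnessLib

/-!
# The 2D control: obligation (M) of certificate `eps101` IN THE KERNEL — part 3 of 4 (runs `37 ≤ j < 73`)
(cell `pub-ising3x`, seat controls-1; kernel runs of `Control2DMidCheck.lean`; pattern of
`Control2DEps102MidA.lean` / `Control2DEps102Mid.lean`)

HONEST FRAMING: lottery ticket; floor = tightest certified 3D Ising CFT bounds; no exact-solution
claim without a proof.

Continuation of the kernel runs of the (M) checker on certificate `eps101` (data and exception table in part 1). 17 `checkRange` runs in all (`decide +kernel`; no `native_decide`, no extra axioms; `maxHeartbeats` 2·10⁸, see the run files), chunked so that each takes ≲ 40 s of kernel time; parts B and C import only part A, the final part imports B and C (flat chain, shorter farm-build lag).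
-/

namespace Summit.CriticalPhenomena.Ising3D.Control2D.RB0

open Set
open Literature.MathematicalPhysics.QuantumFieldTheory.ConformalBootstrap3D
open Summit.CriticalPhenomena.Ising3D.Control2D

set_option maxHeartbeats 200000000 in
set_option maxRecDepth 200000 in
/-- (M) of `eps101`, indices `j = 37 … 40`. [folklore] -/
theorem eps101_mid_run10 : checkRange 80 eps101_mdata eps101_exc 24 120 37 4 = true := by
  decide +kernel

set_option maxHeartbeats 200000000 in
set_option maxRecDepth 200000 in
/-- (M) of `eps101`, indices `j = 41 … 45`. [folklore] -/
theorem eps101_mid_run11 : checkRange 80 eps101_mdata eps101_exc 24 120 41 5 = true := by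
  decide +kernel

set_option maxHeartbeats 200000000 in
set_option maxRecDepth 200000 in
/-- (M) of `eps101`, indices `j = 46 … 51`. [folklore] -/
theorem eps101_mid_run12 : checkRange 80 eps101_mdata eps101_exc 24 120 46 6 = true := by
  decide +kernel

set_option maxHeartbeats 200000000 in
set_option maxRecDepth 200000 in
/-- (M) of `eps101`, indices `j = 52 … 59`. [folklore] -/
theorem eps101_mid_run13 : checkRange 80 eps101_mdata eps101_exc 24 120 52 8 = true := by
  decide +kernel

set_option maxHeartbeats 200000000 in
set_option maxRecDepth 200000 in
/-- (M) of `eps101`, indices `j = 60 … 72`. [folklore] -/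
theorem eps101_mid_run14 : checkRange 80 eps101_mdata eps101_exc 24 120 60 13 = true := by
  decide +kernel

end Summit.CriticalPhenomena.Ising3D.Control2D.RB0
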